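import Summits.RiemannHypothesis.RiemannHypothesis.Theorems.WeilTwoPrimeDeflE72Def
import Summits.RiemannHypothesis.RiemannHypothesis.Theorems.WeilTwoPrimeDeflE72DataPE23
import Literature.NumberTheory.LFunctions.WeilBlockRowsR
import HarnessLib

/-!
# Deflated two-prime certificate E72: the materialized even block agrees with `P_r + Σ μ ĉ ĉᵀ`, rows 50–59

`WeilCert.checkPmRowG` for certificate E72 (even block), by `decide +kernel`. Pure proof file; nothing is asserted.
-/

noncomputable section

namespace Summit.RiemannHypothesis.RiemannHypothesis.Theorems.EvenWinsBeyondArch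

open Literature.NumberTheory.LFunctions

set_option maxHeartbeats 0 in
/-- Row 50 of the materialized even block is row 50 of `P_r + Σ μ ĉ ĉᵀ` (certificate E72). [folklore] -/
theorem checkPmRowG0_50_weilCertDeflE72 : weilCertDeflE72Base.checkPmRowG weilCertDeflE72P weilCertDeflE72PmE 0 50 = true := by
  decide +kernel

set_option maxHeartbeats 0 in
/-- Row 51 of the materialized even block is row 51 of `P_r + Σ μ ĉ ĉᵀ` (certificate E72). [folklore] -/
theorem checkPmRowG0_51_weilCertDeflE72 : weilCertDeflE72Base.checkPmRowG weilCertDeflE72P weilCertDeflE72PmE 0 51 = true := by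
  decide +kernel

set_option maxHeartbeats 0 in
/-- Row 52 of the materialized even block is row 52 of `P_r + Σ μ ĉ ĉᵀ` (certificate E72). [folklore] -/
theorem checkPmRowG0_52_weilCertDeflE72 : weilCertDeflE72Base.checkPmRowG weilCertDeflE72P weilCertDeflE72PmE 0 52 = true := by
  decide +kernel

set_option maxHeartbeats 0 in
/-- Row 53 of the materialized even block is row 53 of `P_r + Σ μ ĉ ĉᵀ` (certificate E72). [folklore] -/
theorem checkPmRowG0_53_weilCertDeflE72 : weilCertDeflE72Base.checkPmRowG weilCertDeflE72P weilCertDeflE72PmE 0 53 = true := by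
  decide +kernel

set_option maxHeartbeats 0 in
/-- Row 54 of the materialized even block is row 54 of `P_r + Σ μ ĉ ĉᵀ` (certificate E72). [folklore] -/
theorem checkPmRowG0_54_weilCertDeflE72 : weilCertDeflE72Base.checkPmRowG weilCertDeflE72P weilCertDeflE72PmE 0 54 = true := by
  decide +kernel

set_option maxHeartbeats 0 in
/-- Row 55 of the materialized even block is row 55 of `P_r + Σ μ ĉ ĉᵀ` (certificate E72). [folklore] -/
theorem checkPmRowG0_55_weilCertDeflE72 : weilCertDeflE72Base.checkPmRowG weilCertDeflE72P weilCertDeflE72PmE 0 55 = true := by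
  decide +kernel

set_option maxHeartbeats 0 in
/-- Row 56 of the materialized even block is row 56 of `P_r + Σ μ ĉ ĉᵀ` (certificate E72). [folklore] -/
theorem checkPmRowG0_56_weilCertDeflE72 : weilCertDeflE72Base.checkPmRowG weilCertDeflE72P weilCertDeflE72PmE 0 56 = true := by
  decide +kernel

set_option maxHeartbeats 0 in
/-- Row 57 of the materialized even block is row 57 of `P_r + Σ μ ĉ ĉᵀ` (certificate E72). [folklore] -/
theorem checkPmRowG0_57_weilCertDeflE72 : weilCertDeflE72Base.checkPmRowG weilCertDeflE72P weilCertDeflE72PmE 0 57 = true := by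
  decide +kernel

set_option maxHeartbeats 0 in
/-- Row 58 of the materialized even block is row 58 of `P_r + Σ μ ĉ ĉᵀ` (certificate E72). [folklore] -/
theorem checkPmRowG0_58_weilCertDeflE72 : weilCertDeflE72Base.checkPmRowG weilCertDeflE72P weilCertDeflE72PmE 0 58 = true := by
  decide +kernel

set_option maxHeartbeats 0 in
/-- Row 59 of the materialized even block is row 59 of `P_r + Σ μ ĉ ĉᵀ` (certificate E72). [folklore] -/
theorem checkPmRowG0_59_weilCertDeflE72 : weilCertDeflE72Base.checkPmRowG weilCertDeflE72P weilCertDeflE72PmE 0 59 = true := by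
  decide +kernel


end Summit.RiemannHypothesis.RiemannHypothesis.Theorems.EvenWinsBeyondArch
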